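import Summits.CriticalPhenomena.PercolationContinuityZ3.Theorems.PercNearOneGluingNoHeavyLowerTailSunflowerWSplit
import Summits.CriticalPhenomena.PercolationContinuityZ3.Theorems.PercNearOneGluingNoHeavyLowerTailSunflowerPendantBound
import HarnessLib

/-!
# `NoHeavyLowerTail` (crux stmt-CriticalPhenomena-4575), abstract sunflower cubic: the `{w=1}`-face budget (BW) is a
# CONSEQUENCE of the cell budgets `(Bk)`, `(Bh)`, the `H`-face budget `(BH)` and the link `g ≤ k` — by the pendant
# analytic lemma; hence `res0_yfloor` and `res0_Wdominant` (gen 59) are theorems from the six legitimate budgets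

Support file (seat `prim-ineq-prove-1` gen 61; `--supports stmt-CriticalPhenomena-4575`).  No `sorry`, no named facts.
Memo: run/shared/lean/prim/prim-ineq-prove-1/FINDING-SIXW-prove1-g61.md.

THE OBSERVATION.  In the two-linked-systems model of (RES0′) (`…SunflowerLinkedCurrency`, `…SunflowerWSplit`; coins
`τ, σ, s`, floors `α₀₀ ≤ α₀₁ ≤ α₁₁`, petals `(y,k,g,h)`, `G = c₀ + τ(1−σ)Ȳ + s(1−τ)H`) the value of a petal on the face
`{w=1}` is `W = τσ + τ(1−σ)k + (1−τ)((1−σ)g + σh)`, i.e. LETTER FOR LETTER the factor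
`st + s(1−t)vv + (1−s)t u + (1−s)(1−t)m` of the pendant analytic lemma `Pendant.pendant_prod_le` (gen 49) with
`(s,t,b,β) := (σ,τ,α₀₁,α₁₁)` and `(u,vv,m) := (k,h,g)`: its hypotheses are exactly the cell budgets `∏ k_j ≤ α₀₁^(n−1)`,
`∏ h_j ≤ α₁₁^(n−1)`, the `H`-face budget `∏((1−σ)g_j + σh_j) ≤ b_H^(n−1)` and the link `α₀₁ ≤ g_j ≤ k_j`, and its
conclusion is the `{w=1}`-face budget `(BW) ∏ W_j ≤ w_f^(n−1)` (`budgetW_of_cells`).  Consequences: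
* the face `s = 1` of (RES0′) (where `G = W`) is a kernel theorem from `(Bk)+(Bh)+(BH)` for every number of petals;
* gen 59's `res0_yfloor` (every family with `y` at its floor: all leverage dwarfs, h-petals, H-hubs, k-hubs, every
  resonant family `α₁₁^N = α₀₁^(N−1)`) and `res0_Wdominant` hold from the six legitimate budgets
  (`res0_yfloor_six`, `res0_Wdominant_six`) — no `{w=1}`-face hypothesis is needed anywhere in the programme;
* gen 60's census line "(BW) adds nothing once (BH) is present" is a theorem, and the refutation `not_resZeroSixBudgets`
  (the `(BH)`-violating family satisfying `(BW)`) shows the converse implication fails.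
-/

noncomputable section

namespace Summit.CriticalPhenomena.PercolationContinuityZ3.Theorems.SunflowerPartition

namespace SafeCalc

namespace LinkedCurrency

open Finset

variable {κ : Type*}

/-- Re-indexing a `Finset` product over `κ` as a product over `Fin S.card` (via `S.equivFin`). [folklore] -/
theorem prod_eq_prod_fin_equiv (S : Finset κ) (f : κ → ℝ) :
    ∏ j ∈ S, f j = ∏ i : Fin S.card, f ((S.equivFin.symm i : S) : κ) := by
  rw [← prod_coe_sort S f]
  exact Fintype.prod_equiv S.equivFin (fun i : S => f i) (fun i => f ((S.equivFin.symm i : S) : κ))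
    (fun a => by simp)

/-- **The `{w=1}`-face budget from the cells and the `H`-face.**  Coins `0 ≤ τ ≤ 1`, `0 ≤ σ ≤ 1`, floors
`0 < α₀₁ ≤ α₁₁`; petals with `α₀₁ ≤ g_j ≤ k_j`, `α₁₁ ≤ h_j` (no caps); budgets `∏ k_j ≤ α₀₁^(|S|−1)`,
`∏ h_j ≤ α₁₁^(|S|−1)`, `∏ ((1−σ)g_j + σh_j) ≤ ((1−σ)α₀₁ + σα₁₁)^(|S|−1)`.  Then
`∏ (τσ + τ(1−σ)k_j + (1−τ)((1−σ)g_j + σh_j)) ≤ (τσ + τ(1−σ)α₀₁ + (1−τ)((1−σ)α₀₁ + σα₁₁))^(|S|−1)`.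
Proof: `Pendant.pendant_prod_le` with `(s,t,b,β,u,vv,m) := (σ,τ,α₀₁,α₁₁,k,h,g)`. [this work] -/
theorem budgetW_of_cells {τ σ α01 α11 : ℝ} (hτ0 : 0 ≤ τ) (hτ1 : τ ≤ 1) (hσ0 : 0 ≤ σ) (hσ1 : σ ≤ 1)
    (hα01 : 0 < α01) (h11 : α01 ≤ α11) (S : Finset κ) (k gc h : κ → ℝ)
    (hg : ∀ j ∈ S, α01 ≤ gc j) (hgk : ∀ j ∈ S, gc j ≤ k j) (hh : ∀ j ∈ S, α11 ≤ h j)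
    (hBk : ∏ j ∈ S, k j ≤ α01 ^ (S.card - 1)) (hBh : ∏ j ∈ S, h j ≤ α11 ^ (S.card - 1))
    (hBH : ∏ j ∈ S, ((1 - σ) * gc j + σ * h j) ≤ ((1 - σ) * α01 + σ * α11) ^ (S.card - 1)) :
    ∏ j ∈ S, (τ * σ + τ * (1 - σ) * k j + (1 - τ) * ((1 - σ) * gc j + σ * h j)) ≤
      (τ * σ + τ * (1 - σ) * α01 + (1 - τ) * ((1 - σ) * α01 + σ * α11)) ^ (S.card - 1) := by
  classical
  set e := S.equivFin with he
  set u : Fin S.card → ℝ := fun i => k ((e.symm i : S) : κ) with hu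
  set vv : Fin S.card → ℝ := fun i => h ((e.symm i : S) : κ) with hvv
  set m : Fin S.card → ℝ := fun i => gc ((e.symm i : S) : κ) with hm
  have mem : ∀ i : Fin S.card, ((e.symm i : S) : κ) ∈ S := fun i => (e.symm i).2
  have key := Pendant.pendant_prod_le (n := S.card) (b := α01) (β := α11) (s := σ) (t := τ) hα01 h11 hσ0 hσ1
    hτ0 hτ1 u vv m (fun i => (hg _ (mem i)).trans (hgk _ (mem i))) (fun i => hh _ (mem i))
    (fun i => hg _ (mem i)) (fun i => hgk _ (mem i))
    (by rw [hu, ← prod_eq_prod_fin_equiv S k]; exact hBk)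
    (by rw [hvv, ← prod_eq_prod_fin_equiv S h]; exact hBh)
    (by
      have := prod_eq_prod_fin_equiv S (fun j => (1 - σ) * gc j + σ * h j)
      rw [hm, hvv]; rw [← this]; exact hBH)
  have e1 : ∏ j ∈ S, (τ * σ + τ * (1 - σ) * k j + (1 - τ) * ((1 - σ) * gc j + σ * h j)) =
      ∏ i : Fin S.card, (σ * τ + σ * (1 - τ) * vv i + (1 - σ) * τ * u i + (1 - σ) * (1 - τ) * m i) := by
    rw [prod_eq_prod_fin_equiv S]
    refine Fintype.prod_congr _ _ (fun i => ?_)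
    rw [hu, hvv, hm]; ring
  rw [e1]
  refine key.trans (le_of_eq ?_)
  ring

/-- **(RES0′) ∀n for every family with `y` at its floor, from the legitimate budgets `(Bk)`, `(Bh)`, `(BH)` alone.**
Coins `0 < τ < 1`, `0 ≤ σ < 1`, `0 < s < 1`; floors `0 < α₀₀ ≤ α₀₁ ≤ α₁₁ ≤ 1`; `c₀ ≥ τσ + (1−τ)(1−s)α₀₀`; petals
`(α₀₀, k_j, g_j, h_j)` with `α₀₁ ≤ g_j ≤ k_j`, `α₁₁ ≤ h_j`; budgets `∏ k_j ≤ α₀₁^(|S|−1)`, `∏ h_j ≤ α₁₁^(|S|−1)`,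
`∏ H_j ≤ b_H^(|S|−1)`.  Then `∏ G_j ≤ (g*)^(|S|−1)·a`.  (= `res0_yfloor` ∘ `budgetW_of_cells`: every leverage dwarf,
h-petal, H-hub, k-hub family — the whole "free-g × voluntary-h" world and every resonant family — from the six budgets.)
[this work] -/
theorem res0_yfloor_six [DecidableEq κ] {τ σ s α00 α01 α11 c0 : ℝ} (hτ0 : 0 < τ) (hτ1 : τ < 1) (hσ0 : 0 ≤ σ)
    (hσ1 : σ < 1) (hs0 : 0 < s) (hs1 : s < 1) (hα0 : 0 < α00) (h01 : α00 ≤ α01) (h11 : α01 ≤ α11) (hα1 : α11 ≤ 1)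
    (hc0 : τ * σ + (1 - τ) * (1 - s) * α00 ≤ c0)
    (S : Finset κ) (hS : S.Nonempty) (k gc h : κ → ℝ)
    (hg : ∀ j ∈ S, α01 ≤ gc j) (hgk : ∀ j ∈ S, gc j ≤ k j) (hh : ∀ j ∈ S, α11 ≤ h j)
    (hBk : ∏ j ∈ S, k j ≤ α01 ^ (S.card - 1)) (hBh : ∏ j ∈ S, h j ≤ α11 ^ (S.card - 1))
    (hBH : ∏ j ∈ S, ((1 - σ) * gc j + σ * h j) ≤ ((1 - σ) * α01 + σ * α11) ^ (S.card - 1)) :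
    ∏ j ∈ S, (c0 + τ * (1 - σ) * ((1 - s) * α00 + s * k j) + s * (1 - τ) * ((1 - σ) * gc j + σ * h j)) ≤
      (c0 + τ * (1 - σ) * ((1 - s) * α00 + s * α01) + s * (1 - τ) * ((1 - σ) * α01 + σ * α11)) ^ (S.card - 1) *
        (c0 + τ * (1 - σ) + s * (1 - τ)) :=
  res0_yfloor hτ0 hτ1 hσ0 hσ1 hs0 hs1 hα0 h01 h11 hα1 hc0 S hS k gc h
    (fun j hj => (hg j hj).trans (hgk j hj)) hg hh
    (budgetW_of_cells hτ0.le hτ1.le hσ0 hσ1.le (hα0.trans_le h01) h11 S k gc h hg hgk hh hBk hBh hBH)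

/-- **(RES0′) ∀n for W-dominant families, from the legitimate budgets `(By)`, `(Bk)`, `(Bh)`, `(BH)`.**
As `res0_Wdominant` (gen 59: every petal satisfies `w_f·τ(1−σ)(y_j − α₀₀) ≤ u_f·(W_j − w_f)`, relative
`U₀`-excess ≤ relative `W`-excess), with the `{w=1}`-face hypothesis discharged by `budgetW_of_cells` from
`∏ k_j ≤ α₀₁^(|S|−1)`, `∏ h_j ≤ α₁₁^(|S|−1)`, `∏ H_j ≤ b_H^(|S|−1)` and the link `α₀₁ ≤ g_j ≤ k_j`. [this work] -/
theorem res0_Wdominant_six [DecidableEq κ] {τ σ s α00 α01 α11 c0 : ℝ} (hτ0 : 0 < τ) (hτ1 : τ < 1) (hσ0 : 0 ≤ σ)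
    (hσ1 : σ < 1) (hs0 : 0 < s) (hs1 : s < 1) (hα0 : 0 < α00) (h01 : α00 ≤ α01) (h11 : α01 ≤ α11)
    (hc0 : τ * σ + (1 - τ) * (1 - s) * α00 ≤ c0)
    (S : Finset κ) (hS : S.Nonempty) (y k gc h : κ → ℝ)
    (hy : ∀ j ∈ S, α00 ≤ y j) (hg : ∀ j ∈ S, α01 ≤ gc j) (hgk : ∀ j ∈ S, gc j ≤ k j) (hh : ∀ j ∈ S, α11 ≤ h j)
    (hdom : ∀ j ∈ S, (τ * σ + τ * (1 - σ) * α01 + (1 - τ) * ((1 - σ) * α01 + σ * α11)) * (τ * (1 - σ) * (y j - α00)) ≤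
      (τ * σ + τ * (1 - σ) * α00 + (1 - τ) * α00) *
        (τ * σ + τ * (1 - σ) * k j + (1 - τ) * ((1 - σ) * gc j + σ * h j) -
          (τ * σ + τ * (1 - σ) * α01 + (1 - τ) * ((1 - σ) * α01 + σ * α11))))
    (hBy : ∏ j ∈ S, y j ≤ α00 ^ (S.card - 1))
    (hBk : ∏ j ∈ S, k j ≤ α01 ^ (S.card - 1)) (hBh : ∏ j ∈ S, h j ≤ α11 ^ (S.card - 1))
    (hBH : ∏ j ∈ S, ((1 - σ) * gc j + σ * h j) ≤ ((1 - σ) * α01 + σ * α11) ^ (S.card - 1)) :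
    ∏ j ∈ S, (c0 + τ * (1 - σ) * ((1 - s) * y j + s * k j) + s * (1 - τ) * ((1 - σ) * gc j + σ * h j)) ≤
      (c0 + τ * (1 - σ) * ((1 - s) * α00 + s * α01) + s * (1 - τ) * ((1 - σ) * α01 + σ * α11)) ^ (S.card - 1) *
        (c0 + τ * (1 - σ) + s * (1 - τ)) :=
  res0_Wdominant hτ0 hτ1 hσ0 hσ1 hs0 hs1 hα0 h01 h11 hc0 S hS y k gc h hy
    (fun j hj => (hg j hj).trans (hgk j hj)) hg hh hdom
    (budgetW_of_cells hτ0.le hτ1.le hσ0 hσ1.le (hα0.trans_le h01) h11 S k gc h hg hgk hh hBk hBh hBH) hBy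

end LinkedCurrency

end SafeCalc

end Summit.CriticalPhenomena.PercolationContinuityZ3.Theorems.SunflowerPartition
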